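import Summits.ValiantsHypothesis.ValiantsHypothesis.Cruxes.NNLinearDegreeCofactorHard.Lines.xc_division

/-! # Located-face tests for tilted clique rows — diagonal (§1, §2) and entry (§3) tilts (val-idea-41 g3, W6-R1 head start; crux `FifoMatching.NNDivisionHard`,
stmt-ValiantsHypothesis-21181)

W6-R1 (b142) asks for an ENEMY of `diagTilted.Law` (val-idea-39 `Cruxes/NNDivisionHard/CliqueRowBlind.lean` §4): a budgeted
passenger `Q = conv{q_j}` on which the augmented slack of the DIAGONALLY TILTED clique rows
`udRow a + flat (diagonal σ) ≤ 1 + Σ_i max(σ_i, 0)` of `COR(n) + Q` factors nonnegatively through few slots — or a kernel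
NEGATIVE lemma constraining such enemies.  This file proves the first such constraint, in exactly the currency of
`RowFamily.Law` for `diagTilted` (same binders `m, U, V, hfac`):

★ `locatedFace_three_pow_le` — **LOCATED-FACE TEST.**  If the tilted clique-row slack of `COR(n) + Q` factors nonnegatively
through `r + 1` slots, then for EVERY coordinate `i₀` the TOP FACE `F_{i₀}(Q) = argmax_j (q_j)_{i₀ i₀}` is FAT:
`3^{n-1} ≤ |F_{i₀}| · (r + 1) · 2^{n-1}`.

Proof (exact location at finite `K`, no limits): tilt by `σ = μ·e_{i₀}` with `μ·δ > 2B` (`δ` = the gap below the top value of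
`(q_j)_{i₀i₀}`, `B = max |⟨udRow a, q_j⟩|`); then every maximiser of the tilted row over the generators lies in `F_{i₀}`, and
on the columns `(b ∋ i₀, j(a))` (`j(a)` the tilted maximiser) the slack is EXACTLY the unique-disjointness slack
`(1 − |a ∩ b|)²` of `COR(n−1)` (rows `a ∌ i₀`); Yannakakis rectangles refined by the chamber `j(a) ∈ F_{i₀}` and the
Kaibel–Weltge count (`three_pow_le_card_mul_two_pow_of_cover_univ`) give the bound.  PROP B of val-idea-39 (`Q♮`: `F_0 = {q_{{0}}}`,
hence `3^{n-1} ≤ (r+1)·2^{n-1}`) is the instance `|F| = 1`.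

Consequence for the enemy hunt (necessary condition, «hereditary fatness», paper for the iterated version): a `diagTilted`-blind
budgeted passenger must have `|F_{i₀}| ≥ 1.5^{n-1}/(r+1)` for every `i₀` (and, iterating tilts on a flag of coordinates, every
diagonal-located face of codimension-`k` location must carry `≥ 1.5^{n-k}/(r+1)` generators).  In particular affine cubes
`{q_∅ + Σ_{m∈P} D_m}` need `(D_m)_{i i} = 0` for most pairs `i ≠ m` — while the blind identity of `Q♮` uses `(D_m)_{ii} = −1`
for all `i ≠ m` (the `−|P|·I` term) to make its penalties linear in `|a|`.

§2 `locatedFace_three_pow_le_dir` / `locFace_card_ge`: the same for an arbitrary DIAGONAL direction `s` (`Z(s)` = zero set, `F_s` =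
argmax `Σ s_i (q_j)_ii`).  §3 (rev 2) `locatedFace_three_pow_le_mat` / `locFaceM_card_ge`: the same for an arbitrary MATRIX direction `S`
in the currency of `entryTilted.Law` = C⁺ = `LocatedPencilLaw` (rows `udRow a + flat W ≤ 1 + Σ max(W_ik,0)`), under the sign condition
«no negative entry of `S` on `B₊(S) × B₊(S)`» (`hsgn_of_nonneg`, `hsgn_of_diagonal`): `3^{|Z(S)|} ≤ |F_S|·(r+1)·2^{|Z(S)|}`,
`Z(S)` = indices with vanishing row and column (`card_zeroIdx_single_ge : n − 2 ≤ |Z(E_ik)|`).  READING (N14♯): an enemy of C⁺ has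
EVERY entry functional maximised on a face with `≥ 1.5^{n−2}/(r+1)` generators — `Q♮` fails on the diagonal, the constant-diagonal cube
`Q^c` of `BlindConstDiag41.lean` (`¬ diagTilted.Law`) fails off the diagonal.

Nothing here proves or refutes the crux; VP ≠ VNP is NOT proved. -/

set_option linter.dupNamespace false

namespace Summit.ValiantsHypothesis.ValiantsHypothesis.Cruxes.NNDivisionHard.LocatedFace41

open Matrix Finset
open Literature.Barriers.PneNP (HasEFOfSize three_pow_le_card_mul_two_pow_of_cover_univ)
open Literature.Combinatorics.Optimization.FixedSizePsdRank (corPolytope flat vecOuter flat_dotProduct_vecOuter)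
open Summit.ValiantsHypothesis.ValiantsHypothesis.Cruxes.NNLinearDegreeCofactorHard.XcDivision
  (udRow udPt udInd ud_data udInd_apply udRow_dotProduct_flat_diagonal)

/-- the diagonal coordinate `x_{i i}` of a flattened matrix vector. -/
def dcoord {n : ℕ} (i : Fin n) (x : Fin (n * n) → ℝ) : ℝ := x (finProdFinEquiv (i, i))

/-- `⟨flat (diagonal σ), x⟩ = Σ_i σ_i x_{ii}`. -/
theorem flat_diagonal_dotProduct {n : ℕ} (σ : Fin n → ℝ) (x : Fin (n * n) → ℝ) :
    flat (Matrix.diagonal σ) ⬝ᵥ x = ∑ i, σ i * dcoord i x := by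
  unfold flat dotProduct dcoord
  rw [← finProdFinEquiv.sum_comp]
  simp only [Equiv.symm_apply_apply]
  rw [Fintype.sum_prod_type]
  refine Finset.sum_congr rfl fun i _ => ?_
  rw [Finset.sum_eq_single i]
  · rw [Matrix.diagonal_apply_eq]
  · intro j _ hji; rw [Matrix.diagonal_apply_ne _ (Ne.symm hji), zero_mul]
  · intro hi; exact absurd (Finset.mem_univ i) hi

/-- the single-coordinate tilt: `⟨flat (diagonal (μ e_{i₀})), x⟩ = μ x_{i₀ i₀}`. -/
theorem flat_diagonal_single_dotProduct {n : ℕ} (i₀ : Fin n) (μ : ℝ) (x : Fin (n * n) → ℝ) :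
    flat (Matrix.diagonal (Pi.single i₀ μ)) ⬝ᵥ x = μ * dcoord i₀ x := by
  rw [flat_diagonal_dotProduct]
  rw [Finset.sum_eq_single i₀]
  · rw [Pi.single_eq_same]
  · intro j _ hj; rw [Pi.single_eq_of_ne hj, zero_mul]
  · intro hi; exact absurd (Finset.mem_univ i₀) hi

theorem sum_max_single {n : ℕ} (i₀ : Fin n) {μ : ℝ} (hμ : 0 ≤ μ) :
    ∑ i, max (Pi.single (M := fun _ : Fin n => ℝ) i₀ μ i) 0 = μ := by
  rw [Finset.sum_eq_single i₀]
  · rw [Pi.single_eq_same, max_eq_left hμ]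
  · intro j _ hj; rw [Pi.single_eq_of_ne hj, max_self]
  · intro hi; exact absurd (Finset.mem_univ i₀) hi

/-- the TOP FACE of the generator family in the diagonal coordinate `i₀`: `F_{i₀} = argmax_j (q_j)_{i₀i₀}`. -/
noncomputable def topFace {n K : ℕ} (q : Fin (K + 1) → Fin (n * n) → ℝ) (i₀ : Fin n) : Finset (Fin (K + 1)) :=
  Finset.univ.filter fun j => ∀ j', dcoord i₀ (q j') ≤ dcoord i₀ (q j)

theorem topFace_nonempty {n K : ℕ} (q : Fin (K + 1) → Fin (n * n) → ℝ) (i₀ : Fin n) : (topFace q i₀).Nonempty := by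
  obtain ⟨j, -, hj⟩ := Finset.exists_max_image Finset.univ (fun j => dcoord i₀ (q j)) Finset.univ_nonempty
  exact ⟨j, Finset.mem_filter.2 ⟨Finset.mem_univ _, fun j' => hj j' (Finset.mem_univ _)⟩⟩

/-- **exact location**: there is a tilt strength `μ ≥ 0` such that, for every bounded perturbation by the clique-row values,
every maximiser of `j ↦ ⟨udRow a, q_j⟩ + μ (q_j)_{i₀i₀}` lies in the top face `F_{i₀}`. -/
theorem exists_locating_tilt {n K : ℕ} (q : Fin (K + 1) → Fin (n * n) → ℝ) (i₀ : Fin n) :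
    ∃ μ : ℝ, 0 ≤ μ ∧ ∀ (a : Finset (Fin n)) (j₁ : Fin (K + 1)),
      (∀ j, udRow a ⬝ᵥ q j + μ * dcoord i₀ (q j) ≤ udRow a ⬝ᵥ q j₁ + μ * dcoord i₀ (q j₁)) → j₁ ∈ topFace q i₀ := by
  classical
  -- a uniform bound on the clique-row values
  obtain ⟨p₀, -, hB⟩ := Finset.exists_max_image (Finset.univ : Finset (Finset (Fin n) × Fin (K + 1)))
    (fun p => |udRow p.1 ⬝ᵥ q p.2|) ⟨(∅, 0), Finset.mem_univ _⟩
  set B : ℝ := |udRow p₀.1 ⬝ᵥ q p₀.2| with hBdef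
  have hBa : ∀ a j, |udRow a ⬝ᵥ q j| ≤ B := fun a j => hB (a, j) (Finset.mem_univ _)
  have hB0 : 0 ≤ B := abs_nonneg _
  by_cases hall : ∀ j, j ∈ topFace q i₀
  · exact ⟨0, le_rfl, fun a j₁ _ => hall j₁⟩
  push Not at hall
  -- the gap below the top value
  let S : Finset (Fin (K + 1)) := Finset.univ.filter fun j => j ∉ topFace q i₀
  have hS : S.Nonempty := by
    obtain ⟨j, hj⟩ := hall; exact ⟨j, Finset.mem_filter.2 ⟨Finset.mem_univ _, hj⟩⟩
  obtain ⟨jt, hjt⟩ := topFace_nonempty q i₀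
  have htop : ∀ j', dcoord i₀ (q j') ≤ dcoord i₀ (q jt) := (Finset.mem_filter.1 hjt).2
  obtain ⟨js, hjs, hjsmax⟩ := Finset.exists_max_image S (fun j => dcoord i₀ (q j)) hS
  have hlt : ∀ j ∈ S, dcoord i₀ (q j) < dcoord i₀ (q jt) := by
    intro j hj
    have hj' : j ∉ topFace q i₀ := (Finset.mem_filter.1 hj).2
    rcases lt_or_eq_of_le (htop j) with h | h
    · exact h
    · exact absurd (Finset.mem_filter.2 ⟨Finset.mem_univ _, fun j' => h ▸ htop j'⟩) hj'
  set δ : ℝ := dcoord i₀ (q jt) - dcoord i₀ (q js) with hδ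
  have hδpos : 0 < δ := by have := hlt js hjs; rw [hδ]; linarith
  refine ⟨(2 * B + 1) / δ, div_nonneg (by linarith) hδpos.le, fun a j₁ hmaxj => ?_⟩
  by_contra hj₁
  have hj₁S : j₁ ∈ S := Finset.mem_filter.2 ⟨Finset.mem_univ _, hj₁⟩
  have hgap : δ ≤ dcoord i₀ (q jt) - dcoord i₀ (q j₁) := by
    have := hjsmax j₁ hj₁S; rw [hδ]; linarith
  have h1 := hmaxj jt
  have h2 : udRow a ⬝ᵥ q j₁ - udRow a ⬝ᵥ q jt ≤ 2 * B := by
    have e1 := hBa a j₁; have e2 := hBa a jt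
    rw [abs_le] at e1 e2; linarith
  have h3 : (2 * B + 1) / δ * δ = 2 * B + 1 := div_mul_cancel₀ _ hδpos.ne'
  have h4 : (2 * B + 1) / δ * (dcoord i₀ (q jt) - dcoord i₀ (q j₁)) ≥ (2 * B + 1) / δ * δ :=
    mul_le_mul_of_nonneg_left hgap (div_nonneg (by linarith) hδpos.le)
  nlinarith

/-- ★ **LOCATED-FACE TEST** (necessary condition for `diagTilted`-blindness, in the currency of `RowFamily.Law` for the
diagonally tilted clique rows `udRow a + flat (diagonal σ) ≤ 1 + Σ max(σ_i, 0)`): a nonnegative factorization of the augmented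
tilted clique-row slack of `COR(n) + conv{q_j}` through `r + 1` slots forces, for every coordinate `i₀`,
`3^{n-1} ≤ |F_{i₀}| · (r+1) · 2^{n-1}` where `F_{i₀} = argmax_j (q_j)_{i₀ i₀}` is the top face of the generators. -/
theorem locatedFace_three_pow_le {n K r : ℕ} (q : Fin (K + 1) → Fin (n * n) → ℝ)
    (m : Finset (Fin n) × (Fin n → ℝ) → ℝ)
    (hmq : ∀ a j, (udRow a.1 + flat (Matrix.diagonal a.2)) ⬝ᵥ q j ≤ m a)
    (hmax : ∀ a, ∃ j, (udRow a.1 + flat (Matrix.diagonal a.2)) ⬝ᵥ q j = m a)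
    (U : Finset (Fin n) × (Fin n → ℝ) → Option (Fin r) → ℝ) (V : Finset (Fin n) × Fin (K + 1) → Option (Fin r) → ℝ)
    (hU : ∀ a i, 0 ≤ U a i) (hV : ∀ p i, 0 ≤ V p i)
    (hfac : ∀ a b j, (1 + ∑ i, max (a.2 i) 0 + m a) - (udRow a.1 + flat (Matrix.diagonal a.2)) ⬝ᵥ (udPt b + q j) =
      ∑ i, U a i * V (b, j) i)
    (i₀ : Fin n) :
    3 ^ (n - 1) ≤ (topFace q i₀).card * (r + 1) * 2 ^ (n - 1) := by
  classical
  obtain ⟨-, -, slack, diagPt⟩ := ud_data n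
  obtain ⟨μ, hμ, hloc⟩ := exists_locating_tilt q i₀
  let σ : Fin n → ℝ := Pi.single i₀ μ
  -- tilted row values on the generators
  have htilt : ∀ (a : Finset (Fin n)) j, (udRow a + flat (Matrix.diagonal σ)) ⬝ᵥ q j =
      udRow a ⬝ᵥ q j + μ * dcoord i₀ (q j) := by
    intro a j; rw [add_dotProduct, flat_diagonal_single_dotProduct]
  -- the tilted maximiser `jsel a` (from `hmax`) lies in the top face
  choose jsel hjsel using fun a : Finset (Fin n) => hmax (a, σ)
  have hjselF : ∀ a, jsel a ∈ topFace q i₀ := by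
    intro a
    refine hloc a (jsel a) fun j => ?_
    rw [← htilt, ← htilt, hjsel a]
    exact hmq (a, σ) j
  -- the slack on the located columns `(b ∋ i₀, jsel a)` for rows `a ∌ i₀` is the unique-disjointness slack
  have hslack : ∀ a b : Finset (Fin n), i₀ ∈ b →
      ∑ i, U (a, σ) i * V (b, jsel a) i = (1 - ((a ∩ b).card : ℝ)) ^ 2 := by
    intro a b hb
    rw [← hfac (a, σ) b (jsel a)]
    have e1 : (udRow a + flat (Matrix.diagonal σ)) ⬝ᵥ (udPt b + q (jsel a)) =
        udRow a ⬝ᵥ udPt b + flat (Matrix.diagonal σ) ⬝ᵥ udPt b + m (a, σ) := by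
      rw [dotProduct_add, ← hjsel a, add_dotProduct]
    have e2 : flat (Matrix.diagonal σ) ⬝ᵥ udPt b = μ := by
      rw [diagPt]; show ∑ i ∈ b, Pi.single i₀ μ i = μ
      rw [Finset.sum_pi_single']; exact if_pos hb
    have e3 : ∑ i, max (σ i) 0 = μ := sum_max_single i₀ hμ
    simp only at e1 ⊢
    rw [e1, e2, e3, ← slack a b]; ring
  -- pass to the ground set `α = {x // x ≠ i₀}`
  let emb : {x : Fin n // x ≠ i₀} ↪ Fin n := Function.Embedding.subtype _
  let rowOf : Finset {x : Fin n // x ≠ i₀} → Finset (Fin n) := fun a' => a'.map emb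
  let colOf : Finset {x : Fin n // x ≠ i₀} → Finset (Fin n) := fun b' => insert i₀ (b'.map emb)
  have hi₀row : ∀ a', i₀ ∉ rowOf a' := by
    intro a' h
    obtain ⟨x, -, hx⟩ := Finset.mem_map.1 h
    exact x.2 hx
  have hi₀col : ∀ b', i₀ ∈ colOf b' := fun b' => Finset.mem_insert_self _ _
  have hcard : ∀ a' b', (rowOf a' ∩ colOf b').card = (a' ∩ b').card := by
    intro a' b'
    have : rowOf a' ∩ colOf b' = (a' ∩ b').map emb := by
      have h1 : rowOf a' ∩ colOf b' = rowOf a' ∩ b'.map emb := Finset.inter_insert_of_notMem (hi₀row a')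
      rw [h1, Finset.map_inter]
    rw [this, Finset.card_map]
  -- the rectangle cover indexed by (slot, chamber ∈ F)
  let J : Finset (Option (Fin r) × Fin (K + 1)) := Finset.univ ×ˢ topFace q i₀
  have key := three_pow_le_card_mul_two_pow_of_cover_univ (α := {x : Fin n // x ≠ i₀}) J
    (fun ij => {a' | jsel (rowOf a') = ij.2 ∧ 0 < U (rowOf a', σ) ij.1})
    (fun ij => {b' | 0 < V (colOf b', ij.2) ij.1})
    (by
      rintro ⟨i, j⟩ - a' ⟨hja, hUa⟩ b' hVb
      simp only [Set.mem_setOf_eq] at hja hUa hVb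
      intro h1
      have hs := hslack (rowOf a') (colOf b') (hi₀col b')
      rw [hcard, h1] at hs
      have hs0 : ∑ i', U (rowOf a', σ) i' * V (colOf b', jsel (rowOf a')) i' = 0 := by rw [hs]; norm_num
      have hle : U (rowOf a', σ) i * V (colOf b', jsel (rowOf a')) i ≤
          ∑ i', U (rowOf a', σ) i' * V (colOf b', jsel (rowOf a')) i' :=
        Finset.single_le_sum (f := fun i' => U (rowOf a', σ) i' * V (colOf b', jsel (rowOf a')) i')
          (fun i' _ => mul_nonneg (hU _ i') (hV _ i')) (Finset.mem_univ i)
      rw [hs0] at hle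
      rw [hja] at hle
      nlinarith [mul_pos hUa hVb])
    (by
      intro a' b' hab
      have hs := hslack (rowOf a') (colOf b') (hi₀col b')
      rw [hcard, Finset.disjoint_iff_inter_eq_empty.1 hab, Finset.card_empty] at hs
      have hs1 : ∑ i', U (rowOf a', σ) i' * V (colOf b', jsel (rowOf a')) i' = 1 := by rw [hs]; norm_num
      obtain ⟨i', -, hi'⟩ : ∃ i' ∈ (Finset.univ : Finset (Option (Fin r))),
          0 < U (rowOf a', σ) i' * V (colOf b', jsel (rowOf a')) i' := by
        by_contra h
        push Not at h
        have : ∑ i', U (rowOf a', σ) i' * V (colOf b', jsel (rowOf a')) i' ≤ 0 :=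
          Finset.sum_nonpos fun i' hi' => h i' hi'
        linarith
      have hUp : 0 < U (rowOf a', σ) i' := lt_of_le_of_ne (hU _ _) fun h => by
        rw [← h, zero_mul] at hi'; exact lt_irrefl _ hi'
      have hVp : 0 < V (colOf b', jsel (rowOf a')) i' := lt_of_le_of_ne (hV _ _) fun h => by
        rw [← h, mul_zero] at hi'; exact lt_irrefl _ hi'
      exact ⟨(i', jsel (rowOf a')), Finset.mem_product.2 ⟨Finset.mem_univ _, hjselF _⟩,
        show jsel (rowOf a') = jsel (rowOf a') ∧ 0 < U (rowOf a', σ) i' from ⟨rfl, hUp⟩,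
        show 0 < V (colOf b', jsel (rowOf a')) i' from hVp⟩)
  have hα : Fintype.card {x : Fin n // x ≠ i₀} = n - 1 := by
    rw [Fintype.card_subtype_compl, Fintype.card_fin, Fintype.card_unique]
  have hJ : J.card = (r + 1) * (topFace q i₀).card := by
    rw [Finset.card_product, Finset.card_univ, Fintype.card_option, Fintype.card_fin]
  rw [hα, hJ] at key
  calc 3 ^ (n - 1) ≤ (r + 1) * (topFace q i₀).card * 2 ^ (n - 1) := key
    _ = (topFace q i₀).card * (r + 1) * 2 ^ (n - 1) := by ring

/-- Corollary (PROP B generalised): if some diagonal coordinate is maximised by a SINGLE generator then the tilted clique-row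
slack of `COR(n) + Q` has no nonnegative factorization through fewer than `1.5^{n-1} − 1` slots: `3^{n-1} ≤ (r+1)·2^{n-1}`. -/
theorem locatedVertex_three_pow_le {n K r : ℕ} (q : Fin (K + 1) → Fin (n * n) → ℝ)
    (m : Finset (Fin n) × (Fin n → ℝ) → ℝ)
    (hmq : ∀ a j, (udRow a.1 + flat (Matrix.diagonal a.2)) ⬝ᵥ q j ≤ m a)
    (hmax : ∀ a, ∃ j, (udRow a.1 + flat (Matrix.diagonal a.2)) ⬝ᵥ q j = m a)
    (U : Finset (Fin n) × (Fin n → ℝ) → Option (Fin r) → ℝ) (V : Finset (Fin n) × Fin (K + 1) → Option (Fin r) → ℝ)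
    (hU : ∀ a i, 0 ≤ U a i) (hV : ∀ p i, 0 ≤ V p i)
    (hfac : ∀ a b j, (1 + ∑ i, max (a.2 i) 0 + m a) - (udRow a.1 + flat (Matrix.diagonal a.2)) ⬝ᵥ (udPt b + q j) =
      ∑ i, U a i * V (b, j) i)
    (i₀ : Fin n) (hvertex : (topFace q i₀).card ≤ 1) :
    3 ^ (n - 1) ≤ (r + 1) * 2 ^ (n - 1) := by
  have h := locatedFace_three_pow_le q m hmq hmax U V hU hV hfac i₀
  calc 3 ^ (n - 1) ≤ (topFace q i₀).card * (r + 1) * 2 ^ (n - 1) := h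
    _ ≤ 1 * (r + 1) * 2 ^ (n - 1) := by gcongr
    _ = (r + 1) * 2 ^ (n - 1) := by ring


/-! ## §2 The general located-face test: an arbitrary diagonal direction `s` (located flags = lexicographic faces are faces
of a single suitably weighted `s`, so this is the hereditary form) -/

/-- generic exact-location lemma: a weight `μ ≥ 0` such that every maximiser of `j ↦ g a j + μ t j` maximises `t`. -/
theorem exists_locating_weight {A J : Type} [Fintype A] [Fintype J] [Nonempty A] [Nonempty J]
    (g : A → J → ℝ) (t : J → ℝ) :
    ∃ μ : ℝ, 0 ≤ μ ∧ ∀ (a : A) (j₁ : J), (∀ j, g a j + μ * t j ≤ g a j₁ + μ * t j₁) → ∀ j', t j' ≤ t j₁ := by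
  classical
  obtain ⟨p₀, -, hB⟩ := Finset.exists_max_image (Finset.univ : Finset (A × J)) (fun p => |g p.1 p.2|)
    Finset.univ_nonempty
  set B : ℝ := |g p₀.1 p₀.2| with hBdef
  have hBa : ∀ a j, |g a j| ≤ B := fun a j => hB (a, j) (Finset.mem_univ _)
  have hB0 : 0 ≤ B := abs_nonneg _
  let F : Finset J := Finset.univ.filter fun j => ∀ j', t j' ≤ t j
  have hFne : F.Nonempty := by
    obtain ⟨j, -, hj⟩ := Finset.exists_max_image Finset.univ t Finset.univ_nonempty
    exact ⟨j, Finset.mem_filter.2 ⟨Finset.mem_univ _, fun j' => hj j' (Finset.mem_univ _)⟩⟩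
  by_cases hall : ∀ j, j ∈ F
  · exact ⟨0, le_rfl, fun a j₁ _ => (Finset.mem_filter.1 (hall j₁)).2⟩
  push Not at hall
  let S : Finset J := Finset.univ.filter fun j => j ∉ F
  have hS : S.Nonempty := by
    obtain ⟨j, hj⟩ := hall; exact ⟨j, Finset.mem_filter.2 ⟨Finset.mem_univ _, hj⟩⟩
  obtain ⟨jt, hjt⟩ := hFne
  have htop : ∀ j', t j' ≤ t jt := (Finset.mem_filter.1 hjt).2
  obtain ⟨js, hjs, hjsmax⟩ := Finset.exists_max_image S t hS
  have hlt : ∀ j ∈ S, t j < t jt := by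
    intro j hj
    have hj' : j ∉ F := (Finset.mem_filter.1 hj).2
    rcases lt_or_eq_of_le (htop j) with h | h
    · exact h
    · exact absurd (Finset.mem_filter.2 ⟨Finset.mem_univ _, fun j' => h ▸ htop j'⟩) hj'
  set δ : ℝ := t jt - t js with hδ
  have hδpos : 0 < δ := by have := hlt js hjs; rw [hδ]; linarith
  refine ⟨(2 * B + 1) / δ, div_nonneg (by linarith) hδpos.le, fun a j₁ hmaxj => ?_⟩
  by_contra hj₁
  have hj₁F : j₁ ∉ F := fun h => hj₁ (Finset.mem_filter.1 h).2
  have hj₁S : j₁ ∈ S := Finset.mem_filter.2 ⟨Finset.mem_univ _, hj₁F⟩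
  have hgap : δ ≤ t jt - t j₁ := by have := hjsmax j₁ hj₁S; rw [hδ]; linarith
  have h1 := hmaxj jt
  have h2 : g a j₁ - g a jt ≤ 2 * B := by
    have e1 := hBa a j₁; have e2 := hBa a jt
    rw [abs_le] at e1 e2; linarith
  have h3 : (2 * B + 1) / δ * δ = 2 * B + 1 := div_mul_cancel₀ _ hδpos.ne'
  have h4 : (2 * B + 1) / δ * (t jt - t j₁) ≥ (2 * B + 1) / δ * δ :=
    mul_le_mul_of_nonneg_left hgap (div_nonneg (by linarith) hδpos.le)
  nlinarith

/-- the LOCATED FACE of the generators in the diagonal direction `s`: `F_s = argmax_j ⟨diag s, q_j⟩ = argmax_j Σ_i s_i (q_j)_{ii}`. -/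
noncomputable def locFace {n K : ℕ} (q : Fin (K + 1) → Fin (n * n) → ℝ) (s : Fin n → ℝ) : Finset (Fin (K + 1)) :=
  Finset.univ.filter fun j => ∀ j', flat (Matrix.diagonal s) ⬝ᵥ q j' ≤ flat (Matrix.diagonal s) ⬝ᵥ q j

/-- the zero set of the direction (the FREE coordinates of the located `COR` face). -/
noncomputable def zeroSet {n : ℕ} (s : Fin n → ℝ) : Finset (Fin n) := Finset.univ.filter fun i => s i = 0

theorem flat_diagonal_smul_dotProduct {n : ℕ} (μ : ℝ) (s : Fin n → ℝ) (x : Fin (n * n) → ℝ) :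
    flat (Matrix.diagonal (μ • s)) ⬝ᵥ x = μ * (flat (Matrix.diagonal s) ⬝ᵥ x) := by
  rw [flat_diagonal_dotProduct, flat_diagonal_dotProduct, Finset.mul_sum]
  refine Finset.sum_congr rfl fun i _ => ?_
  rw [Pi.smul_apply, smul_eq_mul, mul_assoc]

theorem sum_max_eq_sum_filter_pos {n : ℕ} (s : Fin n → ℝ) :
    ∑ i, max (s i) 0 = ∑ i ∈ Finset.univ.filter (fun i => 0 < s i), s i := by
  rw [Finset.sum_filter]
  refine Finset.sum_congr rfl fun i _ => ?_
  by_cases h : 0 < s i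
  · rw [if_pos h, max_eq_left h.le]
  · rw [if_neg h, max_eq_right (not_lt.1 h)]

/-- ★★ **LOCATED-FACE TEST, general direction** (the hereditary form).  A nonnegative factorization of the augmented
diagonally-tilted clique-row slack of `COR(n) + conv{q_j}` through `r + 1` slots forces, for EVERY diagonal direction
`s : Fin n → ℝ` with zero set `Z(s)`,  `3^{|Z(s)|} ≤ |F_s| · (r+1) · 2^{|Z(s)|}`, `F_s = argmax_j Σ_i s_i (q_j)_{ii}`.
(Proof: tilt by `μ•s` with `μ` from `exists_locating_weight`; on the located columns `b = {s > 0} ∪ b'`, `b' ⊆ Z(s)`, and rows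
`a ⊆ Z(s)` the slack at the tilted maximiser `j(a) ∈ F_s` is exactly `(1 − |a ∩ b'|)²`; Kaibel–Weltge count over `(slot, chamber)`.)
So a `diagTilted`-blind budgeted passenger has `|F_s| ≥ 1.5^{|Z(s)|}/(r+1)` generators on EVERY diagonally located face. -/
theorem locatedFace_three_pow_le_dir {n K r : ℕ} (q : Fin (K + 1) → Fin (n * n) → ℝ)
    (m : Finset (Fin n) × (Fin n → ℝ) → ℝ)
    (hmq : ∀ a j, (udRow a.1 + flat (Matrix.diagonal a.2)) ⬝ᵥ q j ≤ m a)
    (hmax : ∀ a, ∃ j, (udRow a.1 + flat (Matrix.diagonal a.2)) ⬝ᵥ q j = m a)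
    (U : Finset (Fin n) × (Fin n → ℝ) → Option (Fin r) → ℝ) (V : Finset (Fin n) × Fin (K + 1) → Option (Fin r) → ℝ)
    (hU : ∀ a i, 0 ≤ U a i) (hV : ∀ p i, 0 ≤ V p i)
    (hfac : ∀ a b j, (1 + ∑ i, max (a.2 i) 0 + m a) - (udRow a.1 + flat (Matrix.diagonal a.2)) ⬝ᵥ (udPt b + q j) =
      ∑ i, U a i * V (b, j) i)
    (s : Fin n → ℝ) :
    3 ^ (zeroSet s).card ≤ (locFace q s).card * (r + 1) * 2 ^ (zeroSet s).card := by
  classical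
  obtain ⟨-, -, slack, diagPt⟩ := ud_data n
  obtain ⟨μ, hμ, hloc⟩ := exists_locating_weight (A := Finset (Fin n)) (J := Fin (K + 1))
    (fun a j => udRow a ⬝ᵥ q j) (fun j => flat (Matrix.diagonal s) ⬝ᵥ q j)
  let σ : Fin n → ℝ := μ • s
  let Mx : ℝ := ∑ i, max (s i) 0
  have htilt : ∀ (a : Finset (Fin n)) x, (udRow a + flat (Matrix.diagonal σ)) ⬝ᵥ x =
      udRow a ⬝ᵥ x + μ * (flat (Matrix.diagonal s) ⬝ᵥ x) := by
    intro a x; rw [add_dotProduct, flat_diagonal_smul_dotProduct]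
  choose jsel hjsel using fun a : Finset (Fin n) => hmax (a, σ)
  have hjselF : ∀ a, jsel a ∈ locFace q s := by
    intro a
    refine Finset.mem_filter.2 ⟨Finset.mem_univ _, hloc a (jsel a) fun j => ?_⟩
    rw [← htilt, ← htilt, hjsel a]
    exact hmq (a, σ) j
  -- located columns: `Ipos ∪ b'` with `b' ⊆ Z(s)`; rows `a ⊆ Z(s)`
  let Ipos : Finset (Fin n) := Finset.univ.filter fun i => 0 < s i
  have hMx : Mx = ∑ i ∈ Ipos, s i := sum_max_eq_sum_filter_pos s
  have e3 : ∑ i, max (σ i) 0 = μ * Mx := by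
    show ∑ i, max ((μ • s) i) 0 = μ * ∑ i, max (s i) 0
    rw [Finset.mul_sum]
    refine Finset.sum_congr rfl fun i _ => ?_
    rw [Pi.smul_apply, smul_eq_mul, mul_max_of_nonneg _ _ hμ, mul_zero]
  let emb : {x : Fin n // s x = 0} ↪ Fin n := Function.Embedding.subtype _
  let rowOf : Finset {x : Fin n // s x = 0} → Finset (Fin n) := fun a' => a'.map emb
  let colOf : Finset {x : Fin n // s x = 0} → Finset (Fin n) := fun b' => Ipos ∪ b'.map emb
  have hmap0 : ∀ (c' : Finset {x : Fin n // s x = 0}), ∀ i ∈ c'.map emb, s i = 0 := by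
    intro c' i hi
    obtain ⟨x, -, hx⟩ := Finset.mem_map.1 hi
    rw [← hx]; exact x.2
  have hdisj : ∀ c' : Finset {x : Fin n // s x = 0}, Disjoint Ipos (c'.map emb) := by
    intro c'
    refine Finset.disjoint_left.2 fun i hi hi' => ?_
    have h1 : 0 < s i := (Finset.mem_filter.1 hi).2
    have h2 := hmap0 c' i hi'
    linarith
  have e2 : ∀ b', flat (Matrix.diagonal σ) ⬝ᵥ udPt (colOf b') = μ * Mx := by
    intro b'
    rw [diagPt, hMx, Finset.mul_sum]
    show ∑ i ∈ Ipos ∪ b'.map emb, (μ • s) i = _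
    rw [Finset.sum_union (hdisj b')]
    have hz : ∑ i ∈ b'.map emb, (μ • s) i = 0 :=
      Finset.sum_eq_zero fun i hi => by rw [Pi.smul_apply, smul_eq_mul, hmap0 b' i hi, mul_zero]
    rw [hz, add_zero]
    refine Finset.sum_congr rfl fun i _ => ?_
    rw [Pi.smul_apply, smul_eq_mul]
  have hslack : ∀ (a' b' : Finset {x : Fin n // s x = 0}),
      ∑ i, U (rowOf a', σ) i * V (colOf b', jsel (rowOf a')) i = (1 - ((rowOf a' ∩ colOf b').card : ℝ)) ^ 2 := by
    intro a' b'
    rw [← hfac (rowOf a', σ) (colOf b') (jsel (rowOf a'))]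
    have e1 : (udRow (rowOf a') + flat (Matrix.diagonal σ)) ⬝ᵥ (udPt (colOf b') + q (jsel (rowOf a'))) =
        udRow (rowOf a') ⬝ᵥ udPt (colOf b') + flat (Matrix.diagonal σ) ⬝ᵥ udPt (colOf b') + m (rowOf a', σ) := by
      rw [dotProduct_add, ← hjsel (rowOf a'), add_dotProduct]
    simp only at e1 ⊢
    rw [e1, e2, e3, ← slack]; ring
  have hcard : ∀ a' b', (rowOf a' ∩ colOf b').card = (a' ∩ b').card := by
    intro a' b'
    have h0 : rowOf a' ∩ Ipos = ∅ :=
      Finset.disjoint_iff_inter_eq_empty.1 (hdisj a').symm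
    have : rowOf a' ∩ colOf b' = (a' ∩ b').map emb := by
      show a'.map emb ∩ (Ipos ∪ b'.map emb) = _
      rw [Finset.inter_union_distrib_left, Finset.map_inter]
      change rowOf a' ∩ Ipos ∪ (a'.map emb ∩ b'.map emb) = _
      rw [h0, Finset.empty_union]
    rw [this, Finset.card_map]
  let J : Finset (Option (Fin r) × Fin (K + 1)) := Finset.univ ×ˢ locFace q s
  have key := three_pow_le_card_mul_two_pow_of_cover_univ (α := {x : Fin n // s x = 0}) J
    (fun ij => {a' | jsel (rowOf a') = ij.2 ∧ 0 < U (rowOf a', σ) ij.1})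
    (fun ij => {b' | 0 < V (colOf b', ij.2) ij.1})
    (by
      rintro ⟨i, j⟩ - a' ⟨hja, hUa⟩ b' hVb
      simp only [Set.mem_setOf_eq] at hja hUa hVb
      intro h1
      have hs := hslack a' b'
      rw [hcard, h1] at hs
      have hs0 : ∑ i', U (rowOf a', σ) i' * V (colOf b', jsel (rowOf a')) i' = 0 := by rw [hs]; norm_num
      have hle : U (rowOf a', σ) i * V (colOf b', jsel (rowOf a')) i ≤
          ∑ i', U (rowOf a', σ) i' * V (colOf b', jsel (rowOf a')) i' :=
        Finset.single_le_sum (f := fun i' => U (rowOf a', σ) i' * V (colOf b', jsel (rowOf a')) i')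
          (fun i' _ => mul_nonneg (hU _ i') (hV _ i')) (Finset.mem_univ i)
      rw [hs0] at hle
      rw [hja] at hle
      nlinarith [mul_pos hUa hVb])
    (by
      intro a' b' hab
      have hs := hslack a' b'
      rw [hcard, Finset.disjoint_iff_inter_eq_empty.1 hab, Finset.card_empty] at hs
      have hs1 : ∑ i', U (rowOf a', σ) i' * V (colOf b', jsel (rowOf a')) i' = 1 := by rw [hs]; norm_num
      obtain ⟨i', -, hi'⟩ : ∃ i' ∈ (Finset.univ : Finset (Option (Fin r))),
          0 < U (rowOf a', σ) i' * V (colOf b', jsel (rowOf a')) i' := by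
        by_contra h
        push Not at h
        have : ∑ i', U (rowOf a', σ) i' * V (colOf b', jsel (rowOf a')) i' ≤ 0 :=
          Finset.sum_nonpos fun i' hi' => h i' hi'
        linarith
      have hUp : 0 < U (rowOf a', σ) i' := lt_of_le_of_ne (hU _ _) fun h => by
        rw [← h, zero_mul] at hi'; exact lt_irrefl _ hi'
      have hVp : 0 < V (colOf b', jsel (rowOf a')) i' := lt_of_le_of_ne (hV _ _) fun h => by
        rw [← h, mul_zero] at hi'; exact lt_irrefl _ hi'
      exact ⟨(i', jsel (rowOf a')), Finset.mem_product.2 ⟨Finset.mem_univ _, hjselF _⟩,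
        show jsel (rowOf a') = jsel (rowOf a') ∧ 0 < U (rowOf a', σ) i' from ⟨rfl, hUp⟩,
        show 0 < V (colOf b', jsel (rowOf a')) i' from hVp⟩)
  have hα : Fintype.card {x : Fin n // s x = 0} = (zeroSet s).card := by
    rw [Fintype.card_subtype]; rfl
  have hJ : J.card = (r + 1) * (locFace q s).card := by
    rw [Finset.card_product, Finset.card_univ, Fintype.card_option, Fintype.card_fin]
  rw [hα, hJ] at key
  calc 3 ^ (zeroSet s).card ≤ (r + 1) * (locFace q s).card * 2 ^ (zeroSet s).card := key
    _ = (locFace q s).card * (r + 1) * 2 ^ (zeroSet s).card := by ring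

/-- ★ **HEREDITARY FATNESS OF LOCATED FACES** (the necessary condition for a `diagTilted`-blind passenger, real form): under the
hypotheses of `RowFamily.Law` for `diagTilted` (val-idea-39 `CliqueRowBlind.lean` §4 — the binders `m, U, V, hfac` below are literally
its body for `F = diagTilted`), every diagonally located face of the generator family carries at least `1.5^{|Z(s)|}/(r+1)` generators. -/
theorem locFace_card_ge {n K r : ℕ} (q : Fin (K + 1) → Fin (n * n) → ℝ)
    (m : Finset (Fin n) × (Fin n → ℝ) → ℝ)
    (hmq : ∀ a j, (udRow a.1 + flat (Matrix.diagonal a.2)) ⬝ᵥ q j ≤ m a)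
    (hmax : ∀ a, ∃ j, (udRow a.1 + flat (Matrix.diagonal a.2)) ⬝ᵥ q j = m a)
    (U : Finset (Fin n) × (Fin n → ℝ) → Option (Fin r) → ℝ) (V : Finset (Fin n) × Fin (K + 1) → Option (Fin r) → ℝ)
    (hU : ∀ a i, 0 ≤ U a i) (hV : ∀ p i, 0 ≤ V p i)
    (hfac : ∀ a b j, (1 + ∑ i, max (a.2 i) 0 + m a) - (udRow a.1 + flat (Matrix.diagonal a.2)) ⬝ᵥ (udPt b + q j) =
      ∑ i, U a i * V (b, j) i)
    (s : Fin n → ℝ) :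
    (3 / 2 : ℝ) ^ (zeroSet s).card ≤ (locFace q s).card * (r + 1) := by
  have h := locatedFace_three_pow_le_dir q m hmq hmax U V hU hV hfac s
  have h' : (3 : ℝ) ^ (zeroSet s).card ≤ (locFace q s).card * (r + 1) * 2 ^ (zeroSet s).card := by exact_mod_cast h
  have h2 : (0 : ℝ) < 2 ^ (zeroSet s).card := pow_pos (by norm_num) _
  rw [div_pow, div_le_iff₀ h2]
  exact h'


/-! ## §3 (rev 2) The located-face test for ENTRY tilts — the necessary condition for C⁺ = `LocatedPencilLaw`-blindness

The rows of `entryTilted` (val-idea-39 `CliqueRowBlind.lean` §4: `udRow a + flat W ≤ 1 + Σ_{i,m} max(W_im, 0)`, valid by `flat_le_box`)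
are tilted by an arbitrary MATRIX direction.  For a direction `S` whose positive entries see no negative entry (`hsgn`: no negative entry of
`S` on `B₊(S) × B₊(S)`, `B₊(S)` = indices carrying a positive entry — e.g. every single entry `S = E_ik` or `E_ik + E_ki`, every
nonnegative `S`, every diagonal `S`), the same mechanism as §2 locates the face `F_S = argmax_j ⟨flat S, q_j⟩` EXACTLY and embeds
`UDISJ` on the ground set `Z(S) = {i : row i and column i of S vanish}`:  `3^{|Z(S)|} ≤ |F_S| · (r+1) · 2^{|Z(S)|}`.
READING (N14♯ for the C⁺ enemy hunt, b142 W6-R1): an `entryTilted`-blind budgeted passenger needs `|F_S| ≥ 1.5^{|Z(S)|}/(r+1)` for every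
such `S`; with `S = E_ik` (`Z = [n] ∖ {i,k}`): EVERY ENTRY functional `x ↦ x_ik` must be maximised on a face with `≥ 1.5^{n−2}/(r+1)`
generators.  The blind cube `Q♮` fails it on the diagonal (`(q_P)_ii = 2P_i − 1 − |P|`, vertex faces), the constant-diagonal cube `Q^c`
of `BlindConstDiag41.lean` (which refutes `diagTilted.Law`) fails it off the diagonal (`(q^c_P)_ik` is maximised by the single generator
`P = [n] ∖ {i,k}`); for an affine cube `{q_∅ + Σ_{m∈P} D_m}` the condition reads: every entry `(i,k)` is moved by at most
`≈ 0.415·n + log₂(r+1)` of the `n` directions `D_m`. -/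

/-- indices carrying a positive entry of `S` (in their row or column). -/
noncomputable def posIdx {n : ℕ} (S : Matrix (Fin n) (Fin n) ℝ) : Finset (Fin n) :=
  Finset.univ.filter fun i => ∃ k, 0 < S i k ∨ 0 < S k i

/-- indices whose row and column of `S` vanish (the FREE ground set of the located `COR` face). -/
noncomputable def zeroIdx {n : ℕ} (S : Matrix (Fin n) (Fin n) ℝ) : Finset (Fin n) :=
  Finset.univ.filter fun i => ∀ k, S i k = 0 ∧ S k i = 0

/-- the face of the generator family in the matrix direction `S`. -/
noncomputable def locFaceM {n K : ℕ} (q : Fin (K + 1) → Fin (n * n) → ℝ) (S : Matrix (Fin n) (Fin n) ℝ) :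
    Finset (Fin (K + 1)) :=
  Finset.univ.filter fun j => ∀ j', flat S ⬝ᵥ q j' ≤ flat S ⬝ᵥ q j

theorem flat_smul_eq {n : ℕ} (μ : ℝ) (S : Matrix (Fin n) (Fin n) ℝ) : flat (μ • S) = μ • flat S := by
  funext p; rfl

theorem sum_sum_ite_mem {n : ℕ} (b c : Finset (Fin n)) (f : Fin n → Fin n → ℝ) :
    ∑ i, ∑ k, (if i ∈ b then (if k ∈ c then f i k else 0) else 0) = ∑ i ∈ b, ∑ k ∈ c, f i k := by
  classical
  calc ∑ i, ∑ k, (if i ∈ b then (if k ∈ c then f i k else 0) else 0)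
      = ∑ i, (if i ∈ b then ∑ k, (if k ∈ c then f i k else 0) else 0) := by
        refine Finset.sum_congr rfl fun i _ => ?_
        split_ifs
        · rfl
        · simp
    _ = ∑ i ∈ b, ∑ k, (if k ∈ c then f i k else 0) := by rw [Finset.sum_ite_mem, Finset.univ_inter]
    _ = ∑ i ∈ b, ∑ k ∈ c, f i k := by
        refine Finset.sum_congr rfl fun i _ => ?_
        rw [Finset.sum_ite_mem, Finset.univ_inter]

/-- `⟨flat S, 𝟙_b𝟙_bᵀ⟩ = Σ_{i,k ∈ b} S_ik`. -/
theorem flat_dotProduct_udPt {n : ℕ} (S : Matrix (Fin n) (Fin n) ℝ) (b : Finset (Fin n)) :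
    flat S ⬝ᵥ udPt b = ∑ i ∈ b, ∑ k ∈ b, S i k := by
  classical
  show flat S ⬝ᵥ vecOuter n (udInd b) = _
  rw [flat_dotProduct_vecOuter]
  have h : ∀ i k, S i k * (udInd b i * udInd b k) = if i ∈ b then (if k ∈ b then S i k else 0) else 0 := by
    intro i k
    rw [udInd_apply, udInd_apply]
    split_ifs <;> simp
  simp only [h]
  exact sum_sum_ite_mem b b (fun i k => S i k)

/-- under the sign condition, the box bound `Σ max(S_ik, 0)` is the sum of `S` over `B₊(S) × B₊(S)`. -/
theorem sum_max_eq_sum_posIdx {n : ℕ} (S : Matrix (Fin n) (Fin n) ℝ)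
    (hsgn : ∀ i k, i ∈ posIdx S → k ∈ posIdx S → 0 ≤ S i k) :
    ∑ i, ∑ k, max (S i k) 0 = ∑ i ∈ posIdx S, ∑ k ∈ posIdx S, S i k := by
  classical
  have h : ∀ i k, max (S i k) 0 = if i ∈ posIdx S then (if k ∈ posIdx S then S i k else 0) else 0 := by
    intro i k
    by_cases hi : i ∈ posIdx S
    · by_cases hk : k ∈ posIdx S
      · rw [if_pos hi, if_pos hk, max_eq_left (hsgn i k hi hk)]
      · rw [if_pos hi, if_neg hk]
        refine max_eq_right (not_lt.1 fun hpos => hk ?_)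
        exact Finset.mem_filter.2 ⟨Finset.mem_univ _, i, Or.inr hpos⟩
    · rw [if_neg hi]
      refine max_eq_right (not_lt.1 fun hpos => hi ?_)
      exact Finset.mem_filter.2 ⟨Finset.mem_univ _, k, Or.inl hpos⟩
  simp only [h]
  exact sum_sum_ite_mem (posIdx S) (posIdx S) (fun i k => S i k)

/-- ★★ **LOCATED-FACE TEST FOR ENTRY TILTS** (necessary condition for `entryTilted`-blindness, i.e. for an enemy of
C⁺ = `LocatedPencilLaw`).  The binders `m, U, V, hfac` are literally the body of `RowFamily.Law` for `F = entryTilted`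
(rows `(a, W)`, `ρ = udRow a + flat W`, `β = 1 + Σ_{i,k} max(W_ik, 0)`).  For every matrix direction `S` with no negative entry on
`B₊(S) × B₊(S)`:  `3^{|Z(S)|} ≤ |F_S| · (r+1) · 2^{|Z(S)|}`. -/
theorem locatedFace_three_pow_le_mat {n K r : ℕ} (q : Fin (K + 1) → Fin (n * n) → ℝ)
    (m : Finset (Fin n) × Matrix (Fin n) (Fin n) ℝ → ℝ)
    (hmq : ∀ a j, (udRow a.1 + flat a.2) ⬝ᵥ q j ≤ m a)
    (hmax : ∀ a, ∃ j, (udRow a.1 + flat a.2) ⬝ᵥ q j = m a)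
    (U : Finset (Fin n) × Matrix (Fin n) (Fin n) ℝ → Option (Fin r) → ℝ)
    (V : Finset (Fin n) × Fin (K + 1) → Option (Fin r) → ℝ)
    (hU : ∀ a i, 0 ≤ U a i) (hV : ∀ p i, 0 ≤ V p i)
    (hfac : ∀ a b j, (1 + ∑ i, ∑ k, max (a.2 i k) 0 + m a) - (udRow a.1 + flat a.2) ⬝ᵥ (udPt b + q j) =
      ∑ i, U a i * V (b, j) i)
    (S : Matrix (Fin n) (Fin n) ℝ) (hsgn : ∀ i k, i ∈ posIdx S → k ∈ posIdx S → 0 ≤ S i k) :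
    3 ^ (zeroIdx S).card ≤ (locFaceM q S).card * (r + 1) * 2 ^ (zeroIdx S).card := by
  classical
  obtain ⟨-, -, slack, -⟩ := ud_data n
  obtain ⟨μ, hμ, hloc⟩ := exists_locating_weight (A := Finset (Fin n)) (J := Fin (K + 1))
    (fun a j => udRow a ⬝ᵥ q j) (fun j => flat S ⬝ᵥ q j)
  let σ : Matrix (Fin n) (Fin n) ℝ := μ • S
  let Mx : ℝ := ∑ i, ∑ k, max (S i k) 0
  have hsm : flat σ = μ • flat S := flat_smul_eq μ S
  have htilt : ∀ (a : Finset (Fin n)) x, (udRow a + flat σ) ⬝ᵥ x = udRow a ⬝ᵥ x + μ * (flat S ⬝ᵥ x) := by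
    intro a x; rw [add_dotProduct, hsm, smul_dotProduct, smul_eq_mul]
  choose jsel hjsel using fun a : Finset (Fin n) => hmax (a, σ)
  have hjselF : ∀ a, jsel a ∈ locFaceM q S := by
    intro a
    refine Finset.mem_filter.2 ⟨Finset.mem_univ _, hloc a (jsel a) fun j => ?_⟩
    rw [← htilt, ← htilt, hjsel a]
    exact hmq (a, σ) j
  -- located columns: `B₊ ∪ b'` with `b' ⊆ Z(S)`; rows `a ⊆ Z(S)`
  let Ipos : Finset (Fin n) := posIdx S
  have hMx : Mx = ∑ i ∈ Ipos, ∑ k ∈ Ipos, S i k := sum_max_eq_sum_posIdx S hsgn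
  have e3 : ∑ i, ∑ k, max (σ i k) 0 = μ * Mx := by
    show ∑ i, ∑ k, max ((μ • S) i k) 0 = μ * ∑ i, ∑ k, max (S i k) 0
    rw [Finset.mul_sum]
    refine Finset.sum_congr rfl fun i _ => ?_
    rw [Finset.mul_sum]
    refine Finset.sum_congr rfl fun k _ => ?_
    rw [Matrix.smul_apply, smul_eq_mul, mul_max_of_nonneg _ _ hμ, mul_zero]
  let emb : {x : Fin n // ∀ k, S x k = 0 ∧ S k x = 0} ↪ Fin n := Function.Embedding.subtype _
  let rowOf : Finset {x : Fin n // ∀ k, S x k = 0 ∧ S k x = 0} → Finset (Fin n) := fun a' => a'.map emb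
  let colOf : Finset {x : Fin n // ∀ k, S x k = 0 ∧ S k x = 0} → Finset (Fin n) := fun b' => Ipos ∪ b'.map emb
  have hmap0 : ∀ (c' : Finset {x : Fin n // ∀ k, S x k = 0 ∧ S k x = 0}), ∀ i ∈ c'.map emb,
      ∀ k, S i k = 0 ∧ S k i = 0 := by
    intro c' i hi
    obtain ⟨x, -, hx⟩ := Finset.mem_map.1 hi
    rw [← hx]; exact x.2
  have hdisj : ∀ c' : Finset {x : Fin n // ∀ k, S x k = 0 ∧ S k x = 0}, Disjoint Ipos (c'.map emb) := by
    intro c'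
    refine Finset.disjoint_left.2 fun i hi hi' => ?_
    obtain ⟨k, hk⟩ := (Finset.mem_filter.1 hi).2
    have h2 := hmap0 c' i hi' k
    rcases hk with hk | hk
    · rw [h2.1] at hk; exact lt_irrefl _ hk
    · rw [h2.2] at hk; exact lt_irrefl _ hk
  have e2 : ∀ b', flat σ ⬝ᵥ udPt (colOf b') = μ * Mx := by
    intro b'
    rw [hsm, smul_dotProduct, smul_eq_mul, hMx, flat_dotProduct_udPt]
    congr 1
    show ∑ i ∈ Ipos ∪ b'.map emb, ∑ k ∈ Ipos ∪ b'.map emb, S i k = _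
    rw [Finset.sum_union (hdisj b')]
    have hz : ∑ i ∈ b'.map emb, ∑ k ∈ Ipos ∪ b'.map emb, S i k = 0 :=
      Finset.sum_eq_zero fun i hi => Finset.sum_eq_zero fun k _ => (hmap0 b' i hi k).1
    rw [hz, add_zero]
    refine Finset.sum_congr rfl fun i _ => ?_
    rw [Finset.sum_union (hdisj b')]
    have hz' : ∑ k ∈ b'.map emb, S i k = 0 := Finset.sum_eq_zero fun k hk => (hmap0 b' k hk i).2
    rw [hz', add_zero]
  have hslack : ∀ (a' b' : Finset {x : Fin n // ∀ k, S x k = 0 ∧ S k x = 0}),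
      ∑ i, U (rowOf a', σ) i * V (colOf b', jsel (rowOf a')) i = (1 - ((rowOf a' ∩ colOf b').card : ℝ)) ^ 2 := by
    intro a' b'
    rw [← hfac (rowOf a', σ) (colOf b') (jsel (rowOf a'))]
    have e1 : (udRow (rowOf a') + flat σ) ⬝ᵥ (udPt (colOf b') + q (jsel (rowOf a'))) =
        udRow (rowOf a') ⬝ᵥ udPt (colOf b') + flat σ ⬝ᵥ udPt (colOf b') + m (rowOf a', σ) := by
      rw [dotProduct_add, ← hjsel (rowOf a'), add_dotProduct]
    simp only at e1 ⊢
    rw [e1, e2, e3, ← slack]; ring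
  have hcard : ∀ a' b', (rowOf a' ∩ colOf b').card = (a' ∩ b').card := by
    intro a' b'
    have h0 : rowOf a' ∩ Ipos = ∅ :=
      Finset.disjoint_iff_inter_eq_empty.1 (hdisj a').symm
    have : rowOf a' ∩ colOf b' = (a' ∩ b').map emb := by
      show a'.map emb ∩ (Ipos ∪ b'.map emb) = _
      rw [Finset.inter_union_distrib_left, Finset.map_inter]
      change rowOf a' ∩ Ipos ∪ (a'.map emb ∩ b'.map emb) = _
      rw [h0, Finset.empty_union]
    rw [this, Finset.card_map]
  let J : Finset (Option (Fin r) × Fin (K + 1)) := Finset.univ ×ˢ locFaceM q S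
  have key := three_pow_le_card_mul_two_pow_of_cover_univ (α := {x : Fin n // ∀ k, S x k = 0 ∧ S k x = 0}) J
    (fun ij => {a' | jsel (rowOf a') = ij.2 ∧ 0 < U (rowOf a', σ) ij.1})
    (fun ij => {b' | 0 < V (colOf b', ij.2) ij.1})
    (by
      rintro ⟨i, j⟩ - a' ⟨hja, hUa⟩ b' hVb
      simp only [Set.mem_setOf_eq] at hja hUa hVb
      intro h1
      have hs := hslack a' b'
      rw [hcard, h1] at hs
      have hs0 : ∑ i', U (rowOf a', σ) i' * V (colOf b', jsel (rowOf a')) i' = 0 := by rw [hs]; norm_num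
      have hle : U (rowOf a', σ) i * V (colOf b', jsel (rowOf a')) i ≤
          ∑ i', U (rowOf a', σ) i' * V (colOf b', jsel (rowOf a')) i' :=
        Finset.single_le_sum (f := fun i' => U (rowOf a', σ) i' * V (colOf b', jsel (rowOf a')) i')
          (fun i' _ => mul_nonneg (hU _ i') (hV _ i')) (Finset.mem_univ i)
      rw [hs0] at hle
      rw [hja] at hle
      nlinarith [mul_pos hUa hVb])
    (by
      intro a' b' hab
      have hs := hslack a' b'
      rw [hcard, Finset.disjoint_iff_inter_eq_empty.1 hab, Finset.card_empty] at hs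
      have hs1 : ∑ i', U (rowOf a', σ) i' * V (colOf b', jsel (rowOf a')) i' = 1 := by rw [hs]; norm_num
      obtain ⟨i', -, hi'⟩ : ∃ i' ∈ (Finset.univ : Finset (Option (Fin r))),
          0 < U (rowOf a', σ) i' * V (colOf b', jsel (rowOf a')) i' := by
        by_contra h
        push Not at h
        have : ∑ i', U (rowOf a', σ) i' * V (colOf b', jsel (rowOf a')) i' ≤ 0 :=
          Finset.sum_nonpos fun i' hi' => h i' hi'
        linarith
      have hUp : 0 < U (rowOf a', σ) i' := lt_of_le_of_ne (hU _ _) fun h => by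
        rw [← h, zero_mul] at hi'; exact lt_irrefl _ hi'
      have hVp : 0 < V (colOf b', jsel (rowOf a')) i' := lt_of_le_of_ne (hV _ _) fun h => by
        rw [← h, mul_zero] at hi'; exact lt_irrefl _ hi'
      exact ⟨(i', jsel (rowOf a')), Finset.mem_product.2 ⟨Finset.mem_univ _, hjselF _⟩,
        show jsel (rowOf a') = jsel (rowOf a') ∧ 0 < U (rowOf a', σ) i' from ⟨rfl, hUp⟩,
        show 0 < V (colOf b', jsel (rowOf a')) i' from hVp⟩)
  have hα : Fintype.card {x : Fin n // ∀ k, S x k = 0 ∧ S k x = 0} = (zeroIdx S).card := by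
    rw [Fintype.card_subtype]; rfl
  have hJ : J.card = (r + 1) * (locFaceM q S).card := by
    rw [Finset.card_product, Finset.card_univ, Fintype.card_option, Fintype.card_fin]
  rw [hα, hJ] at key
  calc 3 ^ (zeroIdx S).card ≤ (r + 1) * (locFaceM q S).card * 2 ^ (zeroIdx S).card := key
    _ = (locFaceM q S).card * (r + 1) * 2 ^ (zeroIdx S).card := by ring

/-- ★ real form: every such located face carries `≥ 1.5^{|Z(S)|}/(r+1)` generators. -/
theorem locFaceM_card_ge {n K r : ℕ} (q : Fin (K + 1) → Fin (n * n) → ℝ)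
    (m : Finset (Fin n) × Matrix (Fin n) (Fin n) ℝ → ℝ)
    (hmq : ∀ a j, (udRow a.1 + flat a.2) ⬝ᵥ q j ≤ m a)
    (hmax : ∀ a, ∃ j, (udRow a.1 + flat a.2) ⬝ᵥ q j = m a)
    (U : Finset (Fin n) × Matrix (Fin n) (Fin n) ℝ → Option (Fin r) → ℝ)
    (V : Finset (Fin n) × Fin (K + 1) → Option (Fin r) → ℝ)
    (hU : ∀ a i, 0 ≤ U a i) (hV : ∀ p i, 0 ≤ V p i)
    (hfac : ∀ a b j, (1 + ∑ i, ∑ k, max (a.2 i k) 0 + m a) - (udRow a.1 + flat a.2) ⬝ᵥ (udPt b + q j) =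
      ∑ i, U a i * V (b, j) i)
    (S : Matrix (Fin n) (Fin n) ℝ) (hsgn : ∀ i k, i ∈ posIdx S → k ∈ posIdx S → 0 ≤ S i k) :
    (3 / 2 : ℝ) ^ (zeroIdx S).card ≤ (locFaceM q S).card * (r + 1) := by
  have h := locatedFace_three_pow_le_mat q m hmq hmax U V hU hV hfac S hsgn
  have h' : (3 : ℝ) ^ (zeroIdx S).card ≤ (locFaceM q S).card * (r + 1) * 2 ^ (zeroIdx S).card := by
    exact_mod_cast h
  rw [div_pow, div_le_iff₀ (by positivity)]
  exact h'

/-- the sign condition holds for every NONNEGATIVE direction (in particular every single entry `E_ik`, every `E_ik + E_ki`). -/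
theorem hsgn_of_nonneg {n : ℕ} (S : Matrix (Fin n) (Fin n) ℝ) (hS : ∀ i k, 0 ≤ S i k) :
    ∀ i k, i ∈ posIdx S → k ∈ posIdx S → 0 ≤ S i k := fun i k _ _ => hS i k

/-- … and for every DIAGONAL direction (so §3 contains §2). -/
theorem hsgn_of_diagonal {n : ℕ} (s : Fin n → ℝ) :
    ∀ i k, i ∈ posIdx (Matrix.diagonal s) → k ∈ posIdx (Matrix.diagonal s) → 0 ≤ Matrix.diagonal s i k := by
  classical
  intro i k hi _
  by_cases h : i = k
  · subst h
    obtain ⟨k', hk'⟩ := (Finset.mem_filter.1 hi).2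
    rcases hk' with hk' | hk'
    · by_cases h' : i = k'
      · subst h'; exact hk'.le
      · rw [Matrix.diagonal_apply_ne _ h'] at hk'; exact (lt_irrefl _ hk').elim
    · by_cases h' : k' = i
      · subst h'; exact hk'.le
      · rw [Matrix.diagonal_apply_ne _ h'] at hk'; exact (lt_irrefl _ hk').elim
  · rw [Matrix.diagonal_apply_ne _ h]

/-- the single-entry instance: `Z(E_ik) ⊇ [n] ∖ {i, k}`, so `|Z| ≥ n − 2`. -/
theorem card_zeroIdx_single_ge {n : ℕ} (i₀ k₀ : Fin n) (c : ℝ) :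
    n - 2 ≤ (zeroIdx (Matrix.of fun i k => if i = i₀ ∧ k = k₀ then c else 0)).card := by
  classical
  have hsub : (Finset.univ : Finset (Fin n)) \ {i₀, k₀} ⊆
      zeroIdx (Matrix.of fun i k => if i = i₀ ∧ k = k₀ then c else 0) := by
    intro i hi
    rw [Finset.mem_sdiff, Finset.mem_insert, Finset.mem_singleton, not_or] at hi
    refine Finset.mem_filter.2 ⟨Finset.mem_univ _, fun k => ⟨?_, ?_⟩⟩
    · rw [Matrix.of_apply, if_neg (fun h => hi.2.1 h.1)]
    · rw [Matrix.of_apply, if_neg (fun h => hi.2.2 h.2)]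
  have h1 := Finset.card_le_card hsub
  have h2 : n - 2 ≤ ((Finset.univ : Finset (Fin n)) \ {i₀, k₀}).card := by
    rw [Finset.card_sdiff_of_subset (Finset.subset_univ _), Finset.card_univ, Fintype.card_fin]
    have : ({i₀, k₀} : Finset (Fin n)).card ≤ 2 := Finset.card_insert_le _ _ |>.trans (by simp)
    omega
  exact h2.trans h1

end Summit.ValiantsHypothesis.ValiantsHypothesis.Cruxes.NNDivisionHard.LocatedFace41
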